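import Literature.Analysis.OperatorTheory.YangMillsMatrixModelDiscreteSpectrum
import Literature.Analysis.FunctionSpaces.SobolevImbeddingSup
import Mathlib.Analysis.FunctionalSpaces.SobolevInequality
import Mathlib.LinearAlgebra.Multilinear.FiniteDimensional
import HarnessLib

/-!
# A sup bound for compactly supported smooth functions on `ℝ⁹` from `L²` norms of derivatives of order `0` and `5`

Topic `Literature/Analysis/OperatorTheory` (vocabulary `ZM = ℝ⁹ = EuclideanSpace ℝ (Fin 3 × Fin 3)` of the matrix-model files).
Pointwise step (N5, part d) of the formalisation of the named fact `LuscherHamiltonianEigenfunctions` (AL1): the Sobolev imbedding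
`W^{5,2}(ℝ⁹) ⊂ L^∞` in the form needed there — for `h ∈ C_c^∞(ℝ⁹)`,

  `μ(B₁) · |h(0)| ≤ ∫_{B₁} |h| + K · (∫ ‖D⁵h‖²)^{1/2}`   (`sobolev_five_pointwise`),

with one constant `K < ∞`.  Proof (Adams, *Sobolev Spaces*, Thm 5.4 Case C with the chain of Lemma 5.14): Morrey's pointwise inequality in
`W^{1,18}` (`p = 18 > 9 = n`, the tree's `Literature.Analysis.FunctionSpaces.morrey_pointwise`) followed by four Gagliardo–Nirenberg–Sobolev
steps `‖D^k h‖_{L^{p_k}} ≤ C ‖D^{k+1} h‖_{L^{p_{k+1}}}` with `(p_1, …, p_5) = (18, 6, 18/5, 18/7, 2)` (`1/p_{k} = 1/p_{k+1} − 1/9`; Mathlib's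
`MeasureTheory.eLpNorm_le_eLpNorm_fderiv_of_eq` applied to the compactly supported `C¹` maps `D^k h = iteratedFDeriv ℝ k h` with values in the
finite-dimensional spaces of continuous `k`-linear forms — finite-dimensionality through the injection into `MultilinearMap`, Mathlib's
`Module.Finite.multilinearMap` — and `‖D(D^k h)(z)‖ = ‖D^{k+1} h(z)‖`, Mathlib's `norm_fderiv_iteratedFDeriv`).

All proved; no definitions, no named facts.

## References
* [Adams1975] R. A. Adams, *Sobolev Spaces* (1975), Lemma 5.14, Lemma 5.15, Thm 5.4 Part I Case C.
-/

noncomputable section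

open MeasureTheory Filter Topology Function Metric Module
open scoped BigOperators ContDiff ENNReal NNReal

namespace Literature.Analysis.OperatorTheory.YMMatrixModel

/-- `dim ℝ⁹ = 9`. [cite: Adams1975, Lemma 5.14] -/
theorem finrank_ZM : finrank ℝ ZM = 9 := by
  rw [finrank_euclideanSpace]; simp

/-- The continuous `k`-linear forms on `ℝ⁹` form a finite-dimensional space (they inject into the algebraic multilinear maps).
[cite: Adams1975, Lemma 5.14] -/
theorem finiteDimensional_multilinear (k : ℕ) : FiniteDimensional ℝ (ZM [×k]→L[ℝ] ℝ) := by
  have : Module.Finite ℝ (MultilinearMap ℝ (fun _ : Fin k => ZM) ℝ) := inferInstance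
  exact Module.Finite.of_injective
    (ContinuousMultilinearMap.toMultilinearMapLinear (R' := ℝ) (A := ℝ) (M₁ := fun _ : Fin k => ZM) (M₂ := ℝ))
    (fun a b h => ContinuousMultilinearMap.toMultilinearMap_injective (by simpa using h))

/-- **One Gagliardo–Nirenberg–Sobolev step on `ℝ⁹` for iterated derivatives**: for `1 ≤ p`, `1/p' = 1/p − 1/9` there is `C` with
`‖D^k h‖_{L^{p'}} ≤ C ‖D^{k+1} h‖_{L^p}` for every compactly supported smooth `h`. [cite: Adams1975, Lemma 5.14] -/
theorem gns_iteratedFDeriv (k : ℕ) {p p' : ℝ≥0} (hp : 1 ≤ p) (hp' : (p' : ℝ)⁻¹ = (p : ℝ)⁻¹ - (9 : ℝ)⁻¹) :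
    ∃ C : ℝ≥0, ∀ h : ZM → ℝ, ContDiff ℝ ∞ h → HasCompactSupport h →
      eLpNorm (iteratedFDeriv ℝ k h) p' volume ≤ C * eLpNorm (iteratedFDeriv ℝ (k + 1) h) p volume := by
  haveI := finiteDimensional_multilinear k
  have hn : 0 < finrank ℝ ZM := by rw [finrank_ZM]; norm_num
  have hp'' : (p' : ℝ)⁻¹ = (p : ℝ)⁻¹ - (finrank ℝ ZM : ℝ)⁻¹ := by rw [finrank_ZM]; exact_mod_cast hp'
  refine ⟨SNormLESNormFDerivOfEqConst (ZM [×k]→L[ℝ] ℝ) (volume : Measure ZM) p, fun h hh hhs => ?_⟩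
  have hu : ContDiff ℝ 1 (iteratedFDeriv ℝ k h) := hh.iteratedFDeriv_right (m := 1) (by exact_mod_cast le_top)
  have h2u : HasCompactSupport (iteratedFDeriv ℝ k h) := hhs.iteratedFDeriv k
  have := eLpNorm_le_eLpNorm_fderiv_of_eq volume hu h2u hp hn hp''
  refine this.trans (le_of_eq ?_)
  congr 1
  exact eLpNorm_congr_norm_ae (Eventually.of_forall fun z => norm_fderiv_iteratedFDeriv (𝕜 := ℝ) (f := h) (x := z) (n := k))

/-- `‖Dh(z)‖ = ‖D¹h(z)‖`. [cite: Adams1975, Lemma 5.14] -/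
theorem norm_fderiv_eq_norm_iteratedFDeriv_one (h : ZM → ℝ) (z : ZM) : ‖fderiv ℝ h z‖ = ‖iteratedFDeriv ℝ 1 h z‖ := by
  rw [← norm_iteratedFDeriv_zero (𝕜 := ℝ) (f := fderiv ℝ h), norm_iteratedFDeriv_fderiv]

/-- ★ **Local Sobolev sup bound on `ℝ⁹`**: there is `K < ∞` such that every compactly supported smooth `h : ℝ⁹ → ℝ` satisfies
`μ(B₁)·‖h(0)‖ ≤ ∫_{B₁}‖h‖ + K (∫ ‖D⁵h‖²)^{1/2}` (all in `ℝ≥0∞`). [cite: Adams1975, Thm 5.4 Part I Case C, Lemma 5.15] -/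
theorem sobolev_five_pointwise :
    ∃ K : ℝ≥0∞, K < ⊤ ∧ ∀ ⦃h : ZM → ℝ⦄, ContDiff ℝ ∞ h → HasCompactSupport h →
      volume (ball (0 : ZM) 1) * ‖h 0‖ₑ ≤
        (∫⁻ z in ball (0 : ZM) 1, ‖h z‖ₑ) + K * (∫⁻ z, ‖iteratedFDeriv ℝ 5 h z‖ₑ ^ (2 : ℝ)) ^ ((1 : ℝ) / 2) := by
  -- Morrey with `p = 18 > 9`
  obtain ⟨K₀, hK₀, hM⟩ := Literature.Analysis.FunctionSpaces.morrey_pointwise (E := ZM) (F := ℝ) (volume : Measure ZM)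
    (p := 18) (by norm_num) (by rw [finrank_ZM]; norm_num)
  -- the four GNS constants
  obtain ⟨C₁, hC₁⟩ := gns_iteratedFDeriv 1 (p := 6) (p' := 18) (by norm_num) (by push_cast; norm_num)
  obtain ⟨C₂, hC₂⟩ := gns_iteratedFDeriv 2 (p := 18 / 5) (p' := 6) ((one_le_div (by norm_num)).mpr (by norm_num))
    (by push_cast; norm_num)
  obtain ⟨C₃, hC₃⟩ := gns_iteratedFDeriv 3 (p := 18 / 7) (p' := 18 / 5) ((one_le_div (by norm_num)).mpr (by norm_num))
    (by push_cast; norm_num)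
  obtain ⟨C₄, hC₄⟩ := gns_iteratedFDeriv 4 (p := 2) (p' := 18 / 7) (by norm_num) (by push_cast; norm_num)
  refine ⟨K₀ * (C₁ * C₂ * C₃ * C₄ : ℝ≥0), ENNReal.mul_lt_top hK₀ ENNReal.coe_lt_top, fun h hh hhs => ?_⟩
  have h1 : ContDiff ℝ 1 h := hh.of_le (by norm_num)
  refine (hM h1).trans ?_
  gcongr ?_ + ?_
  · exact le_rfl
  have e0 : eLpNorm (fderiv ℝ h) (18 : ℝ≥0) volume = eLpNorm (iteratedFDeriv ℝ 1 h) (18 : ℝ≥0) volume :=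
    eLpNorm_congr_norm_ae (Eventually.of_forall fun z => norm_fderiv_eq_norm_iteratedFDeriv_one h z)
  have e1 := hC₁ h hh hhs
  have e2 := hC₂ h hh hhs
  have e3 := hC₃ h hh hhs
  have e4 := hC₄ h hh hhs
  have e5 : eLpNorm (iteratedFDeriv ℝ 5 h) (2 : ℝ≥0) volume = (∫⁻ z, ‖iteratedFDeriv ℝ 5 h z‖ₑ ^ (2 : ℝ)) ^ ((1 : ℝ) / 2) := by
    rw [show ((2 : ℝ≥0) : ℝ≥0∞) = (2 : ℝ≥0∞) by norm_num,
      eLpNorm_eq_lintegral_rpow_enorm_toReal (by norm_num) (by norm_num)]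
    simp only [ENNReal.toReal_ofNat, one_div]
  have chain : eLpNorm (iteratedFDeriv ℝ 1 h) (18 : ℝ≥0) volume ≤
      C₁ * (C₂ * (C₃ * (C₄ * eLpNorm (iteratedFDeriv ℝ 5 h) (2 : ℝ≥0) volume))) :=
    calc eLpNorm (iteratedFDeriv ℝ 1 h) (18 : ℝ≥0) volume ≤ C₁ * eLpNorm (iteratedFDeriv ℝ 2 h) (6 : ℝ≥0) volume := e1
      _ ≤ C₁ * (C₂ * eLpNorm (iteratedFDeriv ℝ 3 h) ((18 / 5 : ℝ≥0) : ℝ≥0∞) volume) := by gcongr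
      _ ≤ C₁ * (C₂ * (C₃ * eLpNorm (iteratedFDeriv ℝ 4 h) ((18 / 7 : ℝ≥0) : ℝ≥0∞) volume)) := by gcongr
      _ ≤ C₁ * (C₂ * (C₃ * (C₄ * eLpNorm (iteratedFDeriv ℝ 5 h) (2 : ℝ≥0) volume))) := by gcongr
  calc K₀ * eLpNorm (fderiv ℝ h) (18 : ℝ≥0) volume
      ≤ K₀ * (C₁ * (C₂ * (C₃ * (C₄ * eLpNorm (iteratedFDeriv ℝ 5 h) (2 : ℝ≥0) volume)))) := by
        rw [e0]
        gcongr
    _ = K₀ * ((C₁ * C₂ * C₃ * C₄ : ℝ≥0) : ℝ≥0∞) * (∫⁻ z, ‖iteratedFDeriv ℝ 5 h z‖ₑ ^ (2 : ℝ)) ^ ((1 : ℝ) / 2) := by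
        rw [e5]; push_cast; ring

end Literature.Analysis.OperatorTheory.YMMatrixModel

end
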